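import Mathlib
import Literature.Probability.Percolation.Percolation
import Literature.Probability.Percolation.RSW
import Literature.Probability.Percolation.PlanarDuality
import HarnessLib

/-!
# Peeling a layer: the deterministic half of the percolation transfer-matrix dictionary

Topic `Literature/Probability/Percolation`. Serves the dictionary step (i) of the named fact
`Literature.Probability.Percolation.IkhlefPonsaingFirstPassage` (Ikhlef–Ponsaing, J. Stat. Phys.
149 (2012), arXiv:1202.5476, §3.1: "Drawing a horizontal line across the width of the lattice, we
consider the connectivities of the loops below the line … We look at all the possible
configurations of two rows of the lattice, and consider how they send a given link pattern to
another. We can write this as a matrix `t` … the transfer matrix"), and equally the row-to-row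
bookkeeping of `Literature/Probability/LatticeModels/PercolationRowTransfer.lean`
(Bondesan–Jacobsen–Saleur 2012, §2; Cardy 2001, §7.1). Folklore graph theory; no single printed
source states it as a lemma.

* `openConnIn_union_iff_eqvGen_peel` — **peeling a layer.** Let `A` be an old region with frontier
  `F ⊆ A` and `B` a new layer such that every OPEN edge from `B` into `A` lands in `F`. Then for
  `x, y ∈ B ∪ F`: `{x ↔ y in A ∪ B}` holds iff `x`, `y` are equivalent under the closure of the
  relation "joined by an open edge (both in `B ∪ F`)" ∪ "both on the frontier and `{u ↔ v in A}`".
  So the connectivity pattern of `B ∪ F` inside `A ∪ B` is a FUNCTION of the pattern of `F` inside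
  `A` and of the open edges meeting `B` — the exactness step of every transfer-matrix computation of
  connection probabilities. Proof: induction along an open walk inside `A ∪ B`, cutting it at its
  visits to `B ∪ F` (a walk leaving `B ∪ F` wanders in `A \ F`, which has no open edge to `B`, and
  re-enters through `F`).
* `diagColumn_frontier`, `diagHalf_succ_eq`, `openConnIn_diagHalf_succ_iff` — the instance for the
  columns `x₀ - x₁ = c` of an arbitrary region `S ⊆ ℤ²` drawn diagonally (IP12's strip
  `0 ≤ x₀ + x₁ ≤ L` is such an `S`): lattice edges change `x₀ - x₁` by `±1`
  (`zdGraph_two_adj_sub_sub`; open edges are lattice edges for `ω ⊆ E(ℤ²)`, cf.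
  `DCT16.adj_of_openGraph_adj`), so column `c + 1` peels off the half-region `x₀ - x₁ ≤ c + 1` with
  frontier column `c`.

Not here: the probabilistic half of the dictionary (independence of the columns' edges under
`bondPercolation`, the stochastic matrix on column patterns and its stationary vector).

## References

* Y. Ikhlef, A. K. Ponsaing, J. Stat. Phys. 149 (2012) 10–36, arXiv:1202.5476, §3.1.
  [IkhlefPonsaing2012]
* R. Bondesan, J. L. Jacobsen, H. Saleur, Nucl. Phys. B 867 (2013) 913–949, arXiv:1207.7005, §2.
  [BondesanJacobsenSaleur2012]
-/

namespace Literature.Probability.Percolation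

open Literature.Probability.LatticeModels

section Peel

variable {V : Type*}

/-- An open edge inside `S` joins its endpoints inside `S`. [folklore] -/
theorem openConnIn_of_openGraph_adj {ω : BondConfig V} {S : Set V} {u v : V} (hu : u ∈ S)
    (hv : v ∈ S) (h : (openGraph ω).Adj u v) : ω ∈ openConnIn S u v :=
  ⟨hu, hv, SimpleGraph.Adj.reachable (by rw [SimpleGraph.induce_adj]; exact h)⟩

/-- `{x ↔ y in S}` is symmetric. [folklore] -/
theorem openConnIn_symm' {ω : BondConfig V} {S : Set V} {x y : V}
    (hxy : ω ∈ openConnIn S x y) : ω ∈ openConnIn S y x := by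
  obtain ⟨hx, hy, h⟩ := hxy
  exact ⟨hy, hx, h.symm⟩

/-- The walk induction behind `openConnIn_union_iff_eqvGen_peel`: along an open walk inside
`A ∪ B` ending in `B ∪ F`, a start point in `B ∪ F` is peel-equivalent to the end point, and a
start point in the deep old region `A \\ F` is joined inside `A` to a frontier point that is.
[folklore] -/
private theorem peel_aux {ω : BondConfig V} {A B F : Set V} (hF : F ⊆ A)
    (hH : ∀ u ∈ B, ∀ v ∈ A, (openGraph ω).Adj u v → v ∈ F)
    {u y : ↥(A ∪ B)} (hy : (y : V) ∈ B ∪ F) (p : ((openGraph ω).induce (A ∪ B)).Walk u y) :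
    ((u : V) ∈ B ∪ F → Relation.EqvGen (fun u v : V =>
        (u ∈ B ∪ F ∧ v ∈ B ∪ F ∧ (openGraph ω).Adj u v) ∨ (u ∈ F ∧ v ∈ F ∧ ω ∈ openConnIn A u v)) u y) ∧
      ((u : V) ∉ B ∪ F → ∃ f ∈ F, ω ∈ openConnIn A u f ∧ Relation.EqvGen (fun u v : V =>
        (u ∈ B ∪ F ∧ v ∈ B ∪ F ∧ (openGraph ω).Adj u v) ∨ (u ∈ F ∧ v ∈ F ∧ ω ∈ openConnIn A u v)) f y) := by
  induction p with
  | nil => exact ⟨fun _ => Relation.EqvGen.refl _, fun h => absurd hy h⟩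
  | cons hadj p ih =>
    rename_i u v w
    have hadj' : (openGraph ω).Adj (u : V) (v : V) := by
      rw [SimpleGraph.induce_adj] at hadj; exact hadj
    obtain ⟨ih₁, ih₂⟩ := ih hy
    -- membership bookkeeping
    have huAB : (u : V) ∈ A ∪ B := u.2
    have hvAB : (v : V) ∈ A ∪ B := v.2
    refine ⟨fun hu => ?_, fun hu => ?_⟩
    · by_cases hv : (v : V) ∈ B ∪ F
      · exact Relation.EqvGen.trans _ _ _ (Relation.EqvGen.rel _ _ (Or.inl ⟨hu, hv, hadj'⟩)) (ih₁ hv)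
      · obtain ⟨f, hfF, hconn, hfy⟩ := ih₂ hv
        have hvA : (v : V) ∈ A := by
          rcases hvAB with h | h
          · exact h
          · exact absurd (Or.inl h) hv
        have huF : (u : V) ∈ F := by
          rcases hu with huB | huF
          · exact absurd (Or.inr (hH _ huB _ hvA hadj')) hv
          · exact huF
        have huv : ω ∈ openConnIn A (u : V) f :=
          PlanarDuality.openConnIn_trans (openConnIn_of_openGraph_adj (hF huF) hvA hadj') hconn
        exact Relation.EqvGen.trans _ _ _ (Relation.EqvGen.rel _ _ (Or.inr ⟨huF, hfF, huv⟩)) hfy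
    · have huA : (u : V) ∈ A := by
        rcases huAB with h | h
        · exact h
        · exact absurd (Or.inl h) hu
      by_cases hv : (v : V) ∈ B ∪ F
      · have hvF : (v : V) ∈ F := by
          rcases hv with hvB | hvF
          · exact absurd (Or.inr (hH _ hvB _ huA hadj'.symm)) hu
          · exact hvF
        exact ⟨v, hvF, openConnIn_of_openGraph_adj huA (hF hvF) hadj', ih₁ hv⟩
      · obtain ⟨f, hfF, hconn, hfy⟩ := ih₂ hv
        have hvA : (v : V) ∈ A := by
          rcases hvAB with h | h
          · exact h
          · exact absurd (Or.inl h) hv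
        exact ⟨f, hfF, PlanarDuality.openConnIn_trans (openConnIn_of_openGraph_adj huA hvA hadj') hconn, hfy⟩

/-- **Peeling a layer.** Let `A` be an old region with frontier `F ⊆ A` and `B` a new layer such
that every open edge from `B` into `A` lands in `F`. Then for points of `B ∪ F`, being joined by an
open path inside `A ∪ B` is the equivalence closure of the peeling relation: open edges within
`B ∪ F`, and frontier pairs joined inside `A`. In words: the connectivity pattern of the new layer
(together with the frontier) is determined by the connectivity pattern of the frontier inside the
old region and by the open edges of the new layer — the exactness step of the transfer-matrix
method (Ikhlef–Ponsaing 2012, §3.1: "we look at all the possible configurations of two rows of the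
lattice, and consider how they send a given link pattern to another"). [folklore] -/
theorem openConnIn_union_iff_eqvGen_peel {ω : BondConfig V} {A B F : Set V} (hF : F ⊆ A)
    (hH : ∀ u ∈ B, ∀ v ∈ A, (openGraph ω).Adj u v → v ∈ F) {x y : V} (hx : x ∈ B ∪ F)
    (hy : y ∈ B ∪ F) :
    ω ∈ openConnIn (A ∪ B) x y ↔ Relation.EqvGen (fun u v : V =>
        (u ∈ B ∪ F ∧ v ∈ B ∪ F ∧ (openGraph ω).Adj u v) ∨ (u ∈ F ∧ v ∈ F ∧ ω ∈ openConnIn A u v)) x y := by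
  have hBF : B ∪ F ⊆ A ∪ B := by
    rintro z (hz | hz)
    · exact Or.inr hz
    · exact Or.inl (hF hz)
  constructor
  · rintro ⟨hx', hy', ⟨p⟩⟩
    exact (peel_aux hF hH (u := ⟨x, hx'⟩) (y := ⟨y, hy'⟩) hy p).1 hx
  · intro h
    suffices H : ∀ a b, Relation.EqvGen (fun u v : V =>
        (u ∈ B ∪ F ∧ v ∈ B ∪ F ∧ (openGraph ω).Adj u v) ∨ (u ∈ F ∧ v ∈ F ∧ ω ∈ openConnIn A u v)) a b →
        ((a ∈ B ∪ F ↔ b ∈ B ∪ F) ∧ (a ∈ B ∪ F → ω ∈ openConnIn (A ∪ B) a b)) from (H x y h).2 hx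
    intro a b hab
    induction hab with
    | rel a b hr =>
      rcases hr with ⟨ha, hb, hadj⟩ | ⟨ha, hb, hconn⟩
      · exact ⟨iff_of_true ha hb, fun _ => openConnIn_of_openGraph_adj (hBF ha) (hBF hb) hadj⟩
      · exact ⟨iff_of_true (Or.inr ha) (Or.inr hb),
          fun _ => openConnIn_mono Set.subset_union_left a b hconn⟩
    | refl a => exact ⟨Iff.rfl, fun ha => ⟨hBF ha, hBF ha, SimpleGraph.Reachable.refl _⟩⟩
    | symm a b _ ih => exact ⟨ih.1.symm, fun hb => openConnIn_symm' (ih.2 (ih.1.2 hb))⟩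
    | trans a b c _ _ ih₁ ih₂ =>
      exact ⟨ih₁.1.trans ih₂.1, fun ha => PlanarDuality.openConnIn_trans (ih₁.2 ha) (ih₂.2 (ih₁.1.1 ha))⟩

end Peel

/-! ### The diagonal strip: columns `x₀ - x₁ = c` peel one at a time -/

section DiagonalColumns

/-- Along an edge of `ℤ²` the difference coordinate `x₀ - x₁` changes by `±1`. [folklore] -/
theorem zdGraph_two_adj_sub_sub {x y : Site 2} (h : (zdGraph 2).Adj x y) :
    (y 0 - y 1) - (x 0 - x 1) = 1 ∨ (y 0 - y 1) - (x 0 - x 1) = -1 := by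
  rw [zdGraph_adj_iff] at h
  obtain ⟨i, h | h⟩ := h <;> fin_cases i <;> simp [h]

/-- Along an edge of `ℤ²` the level `x₀ + x₁` changes by `±1`. [folklore] -/
theorem zdGraph_two_adj_add_sub {x y : Site 2} (h : (zdGraph 2).Adj x y) :
    (y 0 + y 1) - (x 0 + x 1) = 1 ∨ (y 0 + y 1) - (x 0 + x 1) = -1 := by
  rw [zdGraph_adj_iff] at h
  obtain ⟨i, h | h⟩ := h <;> fin_cases i <;> simp [h]

/-- **Frontier hypothesis for diagonal columns.** Inside any region `S ⊆ ℤ²`, an open lattice edge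
from the column `x₀ - x₁ = c + 1` into the half `x₀ - x₁ ≤ c` lands in the column `x₀ - x₁ = c`.
[folklore] -/
theorem diagColumn_frontier {ω : BondConfig (Site 2)} (hω : ω ⊆ (zdGraph 2).edgeSet)
    (S : Set (Site 2)) (c : ℤ) :
    ∀ u ∈ S ∩ {x : Site 2 | x 0 - x 1 = c + 1}, ∀ v ∈ S ∩ {x : Site 2 | x 0 - x 1 ≤ c},
      (openGraph ω).Adj u v → v ∈ S ∩ {x : Site 2 | x 0 - x 1 = c} := by
  rintro u ⟨-, hu⟩ v ⟨hvS, hv⟩ h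
  refine ⟨hvS, ?_⟩
  simp only [Set.mem_setOf_eq] at hu hv ⊢
  have hadj : (zdGraph 2).Adj u v := hω ((openGraph_adj ω u v).1 h).1
  rcases zdGraph_two_adj_sub_sub hadj with h1 | h1 <;> omega

/-- The half `x₀ - x₁ ≤ c + 1` of a region is the half `x₀ - x₁ ≤ c` plus the column `c + 1`. [folklore] -/
theorem diagHalf_succ_eq (S : Set (Site 2)) (c : ℤ) :
    S ∩ {x : Site 2 | x 0 - x 1 ≤ c + 1} =
      (S ∩ {x : Site 2 | x 0 - x 1 ≤ c}) ∪ (S ∩ {x : Site 2 | x 0 - x 1 = c + 1}) := by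
  ext x
  simp only [Set.mem_inter_iff, Set.mem_setOf_eq, Set.mem_union]
  constructor
  · rintro ⟨hS, h⟩
    rcases lt_or_eq_of_le h with h' | h'
    · exact Or.inl ⟨hS, by omega⟩
    · exact Or.inr ⟨hS, h'⟩
  · rintro (⟨hS, h⟩ | ⟨hS, h⟩) <;> exact ⟨hS, by omega⟩

/-- **Column-to-column exactness on a diagonal region** (the deterministic half of IP12 §3.1's
transfer matrix for the strip `S`): for a lattice configuration, two sites of the columns
`x₀ - x₁ ∈ {c, c+1}` are joined by an open path inside the half-region `x₀ - x₁ ≤ c + 1` iff they are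
equivalent under the closure of "open edge between the two columns" and "column-`c` sites joined
inside the half-region `x₀ - x₁ ≤ c`" — the new column's connectivity pattern is a function of the
old column's pattern and the open edges in between. [cite: IkhlefPonsaing2012, §3.1] -/
theorem openConnIn_diagHalf_succ_iff {ω : BondConfig (Site 2)} (hω : ω ⊆ (zdGraph 2).edgeSet)
    (S : Set (Site 2)) (c : ℤ) {x y : Site 2}
    (hx : x ∈ (S ∩ {x : Site 2 | x 0 - x 1 = c + 1}) ∪ (S ∩ {x : Site 2 | x 0 - x 1 = c}))
    (hy : y ∈ (S ∩ {x : Site 2 | x 0 - x 1 = c + 1}) ∪ (S ∩ {x : Site 2 | x 0 - x 1 = c})) :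
    ω ∈ openConnIn (S ∩ {x : Site 2 | x 0 - x 1 ≤ c + 1}) x y ↔
      Relation.EqvGen (fun u v : Site 2 =>
        (u ∈ (S ∩ {x : Site 2 | x 0 - x 1 = c + 1}) ∪ (S ∩ {x : Site 2 | x 0 - x 1 = c}) ∧
          v ∈ (S ∩ {x : Site 2 | x 0 - x 1 = c + 1}) ∪ (S ∩ {x : Site 2 | x 0 - x 1 = c}) ∧
          (openGraph ω).Adj u v) ∨
        (u ∈ S ∩ {x : Site 2 | x 0 - x 1 = c} ∧ v ∈ S ∩ {x : Site 2 | x 0 - x 1 = c} ∧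
          ω ∈ openConnIn (S ∩ {x : Site 2 | x 0 - x 1 ≤ c}) u v)) x y := by
  rw [diagHalf_succ_eq]
  refine openConnIn_union_iff_eqvGen_peel ?_ (diagColumn_frontier hω S c) hx hy
  rintro z ⟨hz, h⟩
  exact ⟨hz, by simp only [Set.mem_setOf_eq] at h ⊢; omega⟩

end DiagonalColumns

end Literature.Probability.Percolation
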